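import Summits.QuantumFields.YangMills.Theses.MirrorModularBoosts
import Summits.QuantumFields.YangMills.Theorems.MirrorModularBoostsDiagonalMirrorRPRefutation

/-!
# `MirrorModularBoosts.NotDiagonalMirrorRP` — the refuted diagonal-mirror RP claim, negated

Route `MirrorModularBoosts` keeps, as the support item `NotDiagonalMirrorRP`
(stmt-QuantumFields-11116), the NEGATION of its first-filing crux `DiagonalMirrorRP`
(stmt-QuantumFields-9665): "for every compact simple `G`, lattice representation `r`, species scheme
`sch` and one-species Schwinger family `S₁` that is the limit of the lattice curvature correlations
for `n ≠ 0` points, a uniform lattice mass gap forces reflection positivity of `S₁` pulled back by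
every diagonal frame `R e₀ = a e₀ + b e₁`, `a² = b² = 1/2`". That crux was refuted by
`Summit.QuantumFields.YangMills.Theorems.MirrorModularBoostsDiagonalMirrorRP_refuted`
(witness: `G = SU(2)`, fundamental `r`, `SpeciesScheme.zero`, `S₁ 0 = -δ`, `S₁ n = 0` for
`n ≠ 0`, the reflection frame `e₀ ↦ (e₀ + e₁)/√2`; the degree-`0` term of (E2) equals `-1`) and
then dropped from the route file; the Theorems record file re-declares the dropped constant
`MirrorModularBoosts.DiagonalMirrorRP` with its original definiens, so that
`NotDiagonalMirrorRP` is *definitionally* `¬ DiagonalMirrorRP` (same term, same namespace and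
`open` context). This file closes the support item by that definitional unfolding — no second copy
of the 215-line witness computation.

Sources: route-internal negative edge (the refutation above); Osterwalder–Schrader reflection
positivity (E2) as formalised in `Literature.MathematicalPhysics.AQFT` (`IsReflectionPositive`).
Deliberately NOT here: the repaired crux `DiagonalMirrorRPR` (open, a different statement).
-/

namespace Summit.QuantumFields.YangMills.Theorems

/-- **`NotDiagonalMirrorRP` holds** (support item stmt-QuantumFields-11116 of route
`MirrorModularBoosts`): it is NOT the case that every one-species family `S₁` which is the
`n ≠ 0` limit of the lattice curvature correlations of a uniformly gapped scheme is reflection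
positive in pull-back form along the diagonal frames. Proof: the route decl unfolds to
`¬ MirrorModularBoosts.DiagonalMirrorRP` (record re-declaration, identical definiens), which is
`MirrorModularBoostsDiagonalMirrorRP_refuted` (witness `SU(2)`, fundamental representation,
zero scheme, `S₁ 0 = -δ`, diagonal reflection frame: the zero-point (E2) term is `-1 < 0`).
[folklore] -/
theorem notDiagonalMirrorRP_proof :
    Summit.QuantumFields.YangMills.Theses.MirrorModularBoosts.NotDiagonalMirrorRP := by
  unfold Summit.QuantumFields.YangMills.Theses.MirrorModularBoosts.NotDiagonalMirrorRP
  exact MirrorModularBoostsDiagonalMirrorRP_refuted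

end Summit.QuantumFields.YangMills.Theorems
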